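import Summits.AtomisticToContinuum.BoseEinsteinCondensation.Theses.BECStronglyRayleigh
import Summits.AtomisticToContinuum.BoseEinsteinCondensation.Theorems.BECStronglyRayleighInsertionFieldDelocalisationExcessBoundRowSum
import HarnessLib

/-!
# Stub `stub_excessBound` (STUB 2) of line `mobile-trap-dirichlet-eigenfunction`, crux
# `BECStronglyRayleigh.InsertionFieldDelocalisation` (stmt-AtomisticToContinuum-9673)

**Convexity of the sector ground energies ⇒ the trapping rate is `O(ν)`.** For hard-core bosons on
`(ℤ/Lℤ)³` (`xyTorus 3 L 1`; occupied = index `0`) write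
`E(k) = lowestEnergyInSector 1 (xyTorus 3 L 1) (k - L³/2)` for the ground energy of `k` bosons. If
`2E(k) ≤ E(k+1) + E(k-1)` for `1 ≤ k`, `k + 1 ≤ L³` (the hypothesis, stub `stub_convexity`), then with
the single constant `C = 60`: `E(N) - E(N-1) + 3 ≤ C N/L³` for all `L ≥ 2`, `2 ≤ N ≤ L³/2`
(the chemical potential exceeds its free value `-3` by at most `O(filling)`).

Proof. (a) Convexity makes `μ_k = E(k) - E(k-1)` nondecreasing, so `N μ_N ≤ E(2N) - E(N)`
(`mt2ex_telescope`). (b) `E(N) ≥ -3N` (row-sum bound, `mt2ex_E_lower` of the `RowSum` helper file).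
(c) The flat trial state `𝟙_n` (indicator of the `n`-boson configurations) has `‖𝟙_n‖² = C(L³, n)`
(`mt2ex_card_config_occ`) and `c_L ⟨𝟙_n, H 𝟙_n⟩ = -3L³ C(L³ - 2, n - 1)` (configurations broken
across a bond, `mt2ex_card_config_occ_ne`), whence `c_L E(n) (L³ - 1) ≤ -3 n (L³ - n)` by the
identity `n (V - n) C(V, n) = V (V - 1) C(V - 2, n - 1)` (`mt2ex_flat_bound`; `c_L = 2` iff `L = 2`,
else `1`). (d) For `L ≥ 3` this gives `(μ_N + 3)(L³ - 1) ≤ 12N - 6`; for `L = 2` the crude bounds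
`E(2N) ≤ 0`, `E(N) ≥ -3N` give `μ_N + 3 ≤ 6 ≤ 60N/8`. [folklore]
-/

noncomputable section

namespace Summit.AtomisticToContinuum.BoseEinsteinCondensation.Cruxes.InsertionFieldDelocalisation.MobileTrapDirichletEigenfunction

open scoped BigOperators ComplexOrder
open Literature.MathematicalPhysics.QuantumLattice Literature.Probability.LatticeModels Matrix Finset
open Summit.AtomisticToContinuum.BoseEinsteinCondensation.Theorems.InsertionFieldDelocalisation.Negative
open Summit.AtomisticToContinuum.BoseEinsteinCondensation.Cruxes.GroundStateStability.StableConeVariationalSelection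
  (gate_ind_apply_eq_iff)

/-! ### Counting configurations: the flat trial state -/

section Counting

variable {Λ : Type*} [Fintype Λ] [DecidableEq Λ]

omit [Fintype Λ] in
/-- The `r`-subsets of `P` avoiding `p` are the `r`-subsets of `P.erase p`. [folklore] -/
theorem mt2ex_filter_not_mem_powersetCard (P : Finset Λ) (r : ℕ) (p : Λ) :
    (P.powersetCard r).filter (fun T => p ∉ T) = (P.erase p).powersetCard r := by
  -- adapted from Literature/NumberTheory/DiophantineGeometry/ValuationProductEllipticManyPrimesProofs.lean
  ext T
  simp only [mem_filter, mem_powersetCard, subset_erase]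
  tauto

omit [Fintype Λ] in
/-- The number of `(r+1)`-subsets of `P` containing a given `p ∈ P` is `C(#P - 1, r)` (Pascal's
rule). [folklore] -/
theorem mt2ex_card_filter_mem_powersetCard (P : Finset Λ) (r : ℕ) {p : Λ} (hp : p ∈ P) :
    ((P.powersetCard (r + 1)).filter (fun T => p ∈ T)).card = (P.card - 1).choose r := by
  -- adapted from Literature/NumberTheory/DiophantineGeometry/ValuationProductEllipticManyPrimesProofs.lean
  have h := card_filter_add_card_filter_not (s := P.powersetCard (r + 1)) (fun T => p ∈ T)
  rw [mt2ex_filter_not_mem_powersetCard, card_powersetCard, card_powersetCard,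
    card_erase_of_mem hp] at h
  obtain ⟨m, hm⟩ : ∃ m, P.card = m + 1 :=
    ⟨P.card - 1, (Nat.succ_pred_eq_of_pos (card_pos.2 ⟨p, hp⟩)).symm⟩
  rw [hm, Nat.add_sub_cancel, Nat.choose_succ_succ'] at h
  rw [hm, Nat.add_sub_cancel]
  omega

/-- `#{S : |S| = r + 1, a ∈ S, b ∉ S} = C(|Λ| - 2, r)` for `a ≠ b`. [folklore] -/
theorem mt2ex_card_sets_mem_not_mem {a b : Λ} (hab : a ≠ b) (r : ℕ) :
    ((univ : Finset (Finset Λ)).filter (fun S => S.card = r + 1 ∧ a ∈ S ∧ b ∉ S)).card =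
      (Fintype.card Λ - 2).choose r := by
  have h1 : (univ : Finset (Finset Λ)).filter (fun S => S.card = r + 1 ∧ a ∈ S ∧ b ∉ S) =
      (((univ.erase b).powersetCard (r + 1)).filter fun S => a ∈ S) := by
    ext S
    simp only [mem_filter, mem_univ, true_and, mem_powersetCard, subset_erase, subset_univ]
    tauto
  rw [h1, mt2ex_card_filter_mem_powersetCard _ _ (mem_erase.2 ⟨hab, mem_univ a⟩),
    card_erase_of_mem (mem_univ b), card_univ, Nat.sub_sub]

/-- The occupied set of an occupation indicator: `{z | (1_S)_z = 0} = S`. [folklore] -/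
theorem mt2ex_filter_ind (S : Finset Λ) :
    (univ.filter fun z => (if z ∈ S then (0 : Fin 2) else 1) = 0) = S := by
  ext z
  by_cases hz : z ∈ S <;> simp [hz]

/-- **The number of `n`-particle configurations is `C(|Λ|, n)`** (occupation indicators
`S ↦ 1_S` biject `n`-subsets with configurations having `n` zeros). [folklore] -/
theorem mt2ex_card_config_occ (n : ℕ) :
    ((univ : Finset (TensorIndex Λ 2)).filter
        fun σ => (univ.filter fun z => σ z = 0).card = n).card = (Fintype.card Λ).choose n := by
  rw [← card_univ, ← card_powersetCard]
  symm
  refine Finset.card_nbij' (fun S z => if z ∈ S then (0 : Fin 2) else 1)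
    (fun σ => univ.filter fun z => σ z = 0) (fun S hS => ?_) (fun σ hσ => ?_) (fun S _ => ?_)
    (fun σ _ => ?_)
  · rw [mem_coe, mem_powersetCard_univ] at hS
    rw [mem_coe, mem_filter, mt2ex_filter_ind]
    exact ⟨mem_univ _, hS⟩
  · rw [mem_coe, mem_filter] at hσ
    rw [mem_coe, mem_powersetCard_univ]
    exact hσ.2
  · exact mt2ex_filter_ind S
  · exact ind_filter_eq σ

/-- **The number of `(r+1)`-particle configurations with `σ_x ≠ σ_y`** (`x ≠ y`) is
`2 C(|Λ| - 2, r)`: the occupied set contains exactly one of `x, y`. [folklore] -/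
theorem mt2ex_card_config_occ_ne {x y : Λ} (hxy : x ≠ y) (r : ℕ) :
    ((univ : Finset (TensorIndex Λ 2)).filter fun σ =>
        (univ.filter fun z => σ z = 0).card = r + 1 ∧ σ x ≠ σ y).card =
      2 * (Fintype.card Λ - 2).choose r := by
  have key : ((univ : Finset (Finset Λ)).filter fun S => S.card = r + 1 ∧ ¬(x ∈ S ↔ y ∈ S)).card =
      ((univ : Finset (TensorIndex Λ 2)).filter fun σ =>
        (univ.filter fun z => σ z = 0).card = r + 1 ∧ σ x ≠ σ y).card := by
    refine Finset.card_nbij' (fun S z => if z ∈ S then (0 : Fin 2) else 1)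
      (fun σ => univ.filter fun z => σ z = 0) (fun S hS => ?_) (fun σ hσ => ?_) (fun S _ => ?_)
      (fun σ _ => ?_)
    · rw [mem_coe, mem_filter] at hS
      rw [mem_coe, mem_filter, mt2ex_filter_ind, Ne, gate_ind_apply_eq_iff]
      exact ⟨mem_univ _, hS.2⟩
    · rw [mem_coe, mem_filter] at hσ
      obtain ⟨-, hcard, hne⟩ := hσ
      refine mem_coe.2 (mem_filter.2 ⟨mem_univ _, hcard, fun hiff => hne ?_⟩)
      have hx : (if x ∈ univ.filter (fun z => σ z = 0) then (0 : Fin 2) else 1) = σ x :=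
        congrFun (ind_filter_eq σ) x
      have hy : (if y ∈ univ.filter (fun z => σ z = 0) then (0 : Fin 2) else 1) = σ y :=
        congrFun (ind_filter_eq σ) y
      rw [← hx, ← hy]
      exact (gate_ind_apply_eq_iff _ x y).2 hiff
    · exact mt2ex_filter_ind S
    · exact ind_filter_eq σ
  rw [← key]
  have hsplit : ((univ : Finset (Finset Λ)).filter fun S => S.card = r + 1 ∧ ¬(x ∈ S ↔ y ∈ S)) =
      (univ.filter fun S => S.card = r + 1 ∧ x ∈ S ∧ y ∉ S) ∪
        (univ.filter fun S => S.card = r + 1 ∧ y ∈ S ∧ x ∉ S) := by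
    ext S
    simp only [mem_union, mem_filter, mem_univ, true_and]
    tauto
  rw [hsplit, card_union_of_disjoint (disjoint_filter.2 fun S _ h1 h2 => h2.2.2 h1.2.1),
    mt2ex_card_sets_mem_not_mem hxy, mt2ex_card_sets_mem_not_mem hxy.symm]
  ring

/-- `n (V - n) C(V, n) = V (V - 1) C(V - 2, n - 1)` (`1 ≤ n ≤ V - 1`), over `ℝ`. [folklore] -/
theorem mt2ex_choose_identity (V n : ℕ) (hn : 1 ≤ n) (hV : 2 ≤ V) (hnV : n ≤ V) :
    ((n : ℝ) * ((V : ℝ) - n)) * (V.choose n : ℝ) =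
      (V : ℝ) * ((V : ℝ) - 1) * ((V - 2).choose (n - 1) : ℝ) := by
  obtain ⟨k, rfl⟩ : ∃ k, n = k + 1 := ⟨n - 1, by omega⟩
  obtain ⟨m, rfl⟩ : ∃ m, V = m + 2 := ⟨V - 2, by omega⟩
  have hk : k ≤ m + 1 := by omega
  have h1 : (m + 2) * (m + 1).choose k = (m + 2).choose (k + 1) * (k + 1) :=
    Nat.add_one_mul_choose_eq (m + 1) k
  have h2 : m.choose k * (m + 1) = (m + 1).choose k * (m + 1 - k) := Nat.choose_mul_succ_eq m k
  have h1' : ((m : ℝ) + 2) * ((m + 1).choose k : ℝ) = ((m + 2).choose (k + 1) : ℝ) * ((k : ℝ) + 1) := by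
    exact_mod_cast h1
  have h2' : (m.choose k : ℝ) * ((m : ℝ) + 1) = ((m + 1).choose k : ℝ) * ((m : ℝ) + 1 - k) := by
    have h3 : (((m + 1 - k : ℕ) : ℝ)) = (m : ℝ) + 1 - k := by
      rw [Nat.cast_sub hk]; push_cast; ring
    rw [← h3]
    exact_mod_cast h2
  rw [Nat.add_sub_cancel, Nat.add_sub_cancel]
  push_cast
  linear_combination (-((m : ℝ) + 1 - k)) * h1' + (-((m : ℝ) + 2)) * h2'

end Counting

/-! ### The flat trial state: `E(n) ≤ -(3/c_L) n (L³ - n)/(L³ - 1)` -/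

section Flat

variable (L : ℕ) [NeZero L]

/-- The flat state `𝟙_n = Σ_{|S| = n} δ_{1_S}` lies in the sector of `n` bosons. [folklore] -/
theorem mt2ex_flat_mem (n : ℕ) (φ : TensorIndex (TorusSite 3 L) 2 → ℂ)
    (hφ : ∀ σ, φ σ = if (univ.filter fun z => σ z = 0).card = n then 1 else 0) :
    φ ∈ spinZSector 1 ((n : ℝ) - (L : ℝ) ^ 3 / 2) := by
  rw [LiebMattis.mem_spinZSector_iff]
  intro σ hσ
  have hn : (univ.filter fun z => σ z = 0).card = n := by
    by_contra h
    exact hσ (by rw [hφ σ, if_neg h])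
  rw [← ind_filter_eq σ, magnetisation_ind, hn, card_torusSite]
  push_cast
  ring

/-- `‖𝟙_n‖² = C(L³, n)`. [folklore] -/
theorem mt2ex_flat_norm (n : ℕ) (φ : TensorIndex (TorusSite 3 L) 2 → ℂ)
    (hφ : ∀ σ, φ σ = if (univ.filter fun z => σ z = 0).card = n then 1 else 0) :
    (star φ ⬝ᵥ φ).re = ((L ^ 3).choose n : ℝ) := by
  rw [mt2ex_re_star_dotProduct_self]
  have h : ∀ σ : TensorIndex (TorusSite 3 L) 2,
      ‖φ σ‖ ^ 2 = if (univ.filter fun z => σ z = 0).card = n then (1 : ℝ) else 0 := by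
    intro σ
    rw [hφ σ]
    split_ifs <;> simp
  simp_rw [h]
  rw [Finset.sum_boole, mt2ex_card_config_occ, card_torusSite]

/-- **One bond in the flat state**: for `x ≠ y`,
`Re ⟨𝟙_{r+1}, (SˣSˣ + SʸSʸ)_{xy} 𝟙_{r+1}⟩ = ½ #{σ : r+1 bosons, σ_x ≠ σ_y} = C(L³ - 2, r)`. [folklore] -/
theorem mt2ex_flat_bond_re {x y : TorusSite 3 L} (hxy : x ≠ y) (r : ℕ)
    (φ : TensorIndex (TorusSite 3 L) 2 → ℂ)
    (hφ : ∀ σ, φ σ = if (univ.filter fun z => σ z = 0).card = r + 1 then 1 else 0) :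
    (star φ ⬝ᵥ (spinBond 1 0 x y + spinBond 1 1 x y + ((0 : ℝ) : ℂ) • spinBond 1 2 x y) *ᵥ φ).re =
      ((L ^ 3 - 2).choose r : ℝ) := by
  rw [mt2ex_bond_form hxy, Complex.re_sum]
  have hterm : ∀ σ : TensorIndex (TorusSite 3 L) 2,
      (if σ x = σ y then (0 : ℂ) else (1 / 2 : ℂ) * (star (φ σ) * φ (σ ∘ Equiv.swap x y))).re =
        if ((univ.filter fun z => σ z = 0).card = r + 1 ∧ σ x ≠ σ y) then (1 / 2 : ℝ) else 0 := by
    intro σ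
    rw [hφ σ, hφ (σ ∘ Equiv.swap x y), mt2ex_card_occ_comp_equiv σ (Equiv.swap x y)]
    by_cases h1 : σ x = σ y <;> by_cases h2 : (univ.filter fun z => σ z = 0).card = r + 1 <;>
      norm_num [h1, h2]
  simp_rw [hterm]
  rw [← Finset.sum_filter, Finset.sum_const, nsmul_eq_mul, mt2ex_card_config_occ_ne hxy,
    card_torusSite]
  push_cast
  ring

/-- **The flat-state variational bound**: for `1 ≤ n = r + 1 ≤ L³`,
`c_L · E(n) · (L³ - 1) ≤ -3 n (L³ - n)`, i.e. `E(n) ≤ -(3/c_L) n(L³ - n)/(L³ - 1)`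
(`E(n) ‖𝟙_n‖² ≤ ⟨𝟙_n, H 𝟙_n⟩ = -(3L³/c_L) C(L³ - 2, n - 1)`, `‖𝟙_n‖² = C(L³, n)`). [folklore] -/
theorem mt2ex_flat_bound (hL : 2 ≤ L) (r : ℕ) (hr : r + 1 ≤ L ^ 3) :
    (if L = 2 then (2 : ℝ) else 1) *
        lowestEnergyInSector 1 (xyTorus 3 L 1) (((r + 1 : ℕ) : ℝ) - (L : ℝ) ^ 3 / 2) *
          ((L : ℝ) ^ 3 - 1) ≤
      -(3 * ((r + 1 : ℕ) : ℝ) * ((L : ℝ) ^ 3 - ((r + 1 : ℕ) : ℝ))) := by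
  set φ : TensorIndex (TorusSite 3 L) 2 → ℂ :=
    fun σ => if (univ.filter fun z => σ z = 0).card = r + 1 then 1 else 0 with hφdef
  have hφ : ∀ σ, φ σ = if (univ.filter fun z => σ z = 0).card = r + 1 then 1 else 0 := fun σ => rfl
  set K := spinZSector (Λ := TorusSite 3 L) 1 (((r + 1 : ℕ) : ℝ) - (L : ℝ) ^ 3 / 2) with hK
  have hmem : φ ∈ K := mt2ex_flat_mem L (r + 1) φ hφ
  have hH : (xyTorus 3 L 1).IsHermitian := xxzZero_isHermitian _ _
  have hray : lowestEnergyInSector 1 (xyTorus 3 L 1) (((r + 1 : ℕ) : ℝ) - (L : ℝ) ^ 3 / 2) *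
      (star φ ⬝ᵥ φ).re ≤ (star φ ⬝ᵥ (xyTorus 3 L 1) *ᵥ φ).re :=
    LiebMattis.mul_norm_le_of_unit_bound 1 (xyTorus 3 L 1) K
      (fun v hv h1 => minEnergyOn_le_rayleigh_of_mem hH K hv h1) hmem
  rw [mt2ex_flat_norm L (r + 1) φ hφ] at hray
  have hform := mt2ex_cL_mul_re_form L hL φ
  have hpair : ∀ (x : TorusSite 3 L) (i : Fin 3),
      (star φ ⬝ᵥ (spinBond 1 0 x (x + Pi.single i 1) + spinBond 1 1 x (x + Pi.single i 1) +
        ((0 : ℝ) : ℂ) • spinBond 1 2 x (x + Pi.single i 1)) *ᵥ φ).re = ((L ^ 3 - 2).choose r : ℝ) :=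
    fun x i => mt2ex_flat_bond_re L (mt2ex_ne_add_single L hL x i) r φ hφ
  simp only [hpair, sum_const, card_univ, card_torusSite, Fintype.card_fin, nsmul_eq_mul] at hform
  have hV8 : 2 ^ 3 ≤ L ^ 3 := Nat.pow_le_pow_left hL 3
  have hchoose := mt2ex_choose_identity (L ^ 3) (r + 1) (by omega) (by omega) hr
  rw [Nat.add_sub_cancel] at hchoose
  push_cast at hform hchoose hray ⊢
  have hQ : (0 : ℝ) < ((L ^ 3).choose (r + 1) : ℝ) := by exact_mod_cast Nat.choose_pos (by omega)
  have hc : (0 : ℝ) < (if L = 2 then (2 : ℝ) else 1) := by split_ifs <;> norm_num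
  have hV1 : (0 : ℝ) ≤ (L : ℝ) ^ 3 - 1 := by
    have : (1 : ℝ) ≤ (L : ℝ) ^ 3 := by exact_mod_cast Nat.one_le_pow _ _ (by omega)
    linarith
  set c := (if L = 2 then (2 : ℝ) else 1) with hcdef
  set E := lowestEnergyInSector 1 (xyTorus 3 L 1) (((r : ℝ) + 1) - (L : ℝ) ^ 3 / 2) with hE
  set R := (star φ ⬝ᵥ (xyTorus 3 L 1) *ᵥ φ).re with hR
  have h1 : c * E * ((L : ℝ) ^ 3 - 1) * ((L ^ 3).choose (r + 1) : ℝ) ≤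
      -(3 * ((r : ℝ) + 1) * ((L : ℝ) ^ 3 - ((r : ℝ) + 1))) * ((L ^ 3).choose (r + 1) : ℝ) := by
    have h2 : c * (E * ((L ^ 3).choose (r + 1) : ℝ)) ≤ c * R := mul_le_mul_of_nonneg_left hray hc.le
    calc c * E * ((L : ℝ) ^ 3 - 1) * ((L ^ 3).choose (r + 1) : ℝ)
        = (c * (E * ((L ^ 3).choose (r + 1) : ℝ))) * ((L : ℝ) ^ 3 - 1) := by ring
      _ ≤ (c * R) * ((L : ℝ) ^ 3 - 1) := mul_le_mul_of_nonneg_right h2 hV1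
      _ = -(3 * ((L ^ 3 - 2).choose r : ℝ) * (L : ℝ) ^ 3 * ((L : ℝ) ^ 3 - 1)) := by rw [hform]; ring
      _ = -(3 * ((r : ℝ) + 1) * ((L : ℝ) ^ 3 - ((r : ℝ) + 1))) * ((L ^ 3).choose (r + 1) : ℝ) := by
          linear_combination (3 : ℝ) * hchoose
  exact le_of_mul_le_mul_right h1 hQ

end Flat

/-! ### Convexity ⇒ telescoping, and the stub -/

/-- **Convex sequences have nondecreasing increments (telescoping)**: if `2E(k) ≤ E(k+1) + E(k-1)`
for `1 ≤ k`, `k + 1 ≤ V`, then `m (E(N) - E(N-1)) ≤ E(N+m) - E(N)` for `1 ≤ N`, `N + m ≤ V`.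
[folklore] -/
theorem mt2ex_telescope (E : ℕ → ℝ) (V N : ℕ) (hN : 1 ≤ N)
    (hconv : ∀ k, 1 ≤ k → k + 1 ≤ V → 2 * E k ≤ E (k + 1) + E (k - 1)) :
    ∀ m, N + m ≤ V → (m : ℝ) * (E N - E (N - 1)) ≤ E (N + m) - E N := by
  have mono : ∀ j, N + j + 1 ≤ V → E N - E (N - 1) ≤ E (N + j + 1) - E (N + j) := by
    intro j
    induction j with
    | zero =>
      intro h
      have := hconv N hN h
      simp only [Nat.add_zero]
      linarith
    | succ j ih =>
      intro h
      have h1 := ih (by omega)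
      have h2 := hconv (N + j + 1) (by omega) (by omega)
      rw [Nat.add_sub_cancel] at h2
      rw [show N + (j + 1) + 1 = N + j + 1 + 1 by omega, show N + (j + 1) = N + j + 1 by omega]
      linarith
  intro m
  induction m with
  | zero =>
    intro _
    simp
  | succ m ih =>
    intro h
    have h1 := ih (by omega)
    have h2 := mono m (by omega)
    rw [show N + (m + 1) = N + m + 1 by omega]
    push_cast
    linarith

/-- **Stub `stub_excessBound`: convexity ⇒ the trapping rate is `O(ν)`.** If the sector ground
energies `E(k)` of `k` hard-core bosons on `(ℤ/Lℤ)³` are convex in `k`, then with `C = 60`,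
`E(N) - E(N-1) + 3 ≤ C N/L³` for all `L ≥ 2`, `2 ≤ N ≤ L³/2`: telescoping `N μ_N ≤ E(2N) - E(N)`,
the flat trial state `c_L E(2N)(L³ - 1) ≤ -6N(L³ - 2N)` and the row-sum bound `E(N) ≥ -3N`. -/
theorem stub_excessBound :
    (∀ (L : ℕ) [NeZero L], 2 ≤ L → ∀ N : ℕ, 1 ≤ N → N + 1 ≤ L ^ 3 →
      2 * lowestEnergyInSector 1 (xyTorus 3 L 1) ((N : ℝ) - (L : ℝ) ^ 3 / 2) ≤
        lowestEnergyInSector 1 (xyTorus 3 L 1) (((N + 1 : ℕ) : ℝ) - (L : ℝ) ^ 3 / 2) +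
          lowestEnergyInSector 1 (xyTorus 3 L 1) (((N - 1 : ℕ) : ℝ) - (L : ℝ) ^ 3 / 2)) →
    ∃ C : ℝ, ∀ (L : ℕ) [NeZero L], 2 ≤ L → ∀ N : ℕ, 2 ≤ N → 2 * N ≤ L ^ 3 →
      lowestEnergyInSector 1 (xyTorus 3 L 1) ((N : ℝ) - (L : ℝ) ^ 3 / 2) -
          lowestEnergyInSector 1 (xyTorus 3 L 1) (((N - 1 : ℕ) : ℝ) - (L : ℝ) ^ 3 / 2) + 3 ≤
        C * N / (L : ℝ) ^ 3 := by
  intro hconv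
  refine ⟨60, fun L _ hL N hN h2N => ?_⟩
  have htel := mt2ex_telescope
    (fun k : ℕ => lowestEnergyInSector 1 (xyTorus 3 L 1) ((k : ℝ) - (L : ℝ) ^ 3 / 2)) (L ^ 3) N
    (by omega) (fun k hk hkV => hconv L hL k hk hkV) N (by omega)
  beta_reduce at htel
  rw [← two_mul] at htel
  have hlow := mt2ex_E_lower L hL N (by omega)
  obtain ⟨r, hr⟩ : ∃ r, 2 * N = r + 1 := ⟨2 * N - 1, by omega⟩
  have hflat := mt2ex_flat_bound L hL r (by omega)
  rw [← hr] at hflat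
  set E2 := lowestEnergyInSector 1 (xyTorus 3 L 1) (((2 * N : ℕ) : ℝ) - (L : ℝ) ^ 3 / 2) with hE2
  set E1 := lowestEnergyInSector 1 (xyTorus 3 L 1) ((N : ℝ) - (L : ℝ) ^ 3 / 2) with hE1
  set E0 := lowestEnergyInSector 1 (xyTorus 3 L 1) (((N - 1 : ℕ) : ℝ) - (L : ℝ) ^ 3 / 2) with hE0
  push_cast at hflat
  have hL3 : (0 : ℝ) < (L : ℝ) ^ 3 := by positivity
  rw [le_div_iff₀ hL3]
  have hN2 : (2 : ℝ) ≤ N := by exact_mod_cast hN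
  have h2NV : 2 * (N : ℝ) ≤ (L : ℝ) ^ 3 := by exact_mod_cast h2N
  have hs1 : (N : ℝ) * (E1 - E0) ≤ E2 + 3 * N := by linarith
  split_ifs at hflat with h2
  · -- `L = 2`: crude bounds suffice
    have hV : (L : ℝ) ^ 3 = 8 := by rw [h2]; norm_num
    rw [hV] at hflat h2NV ⊢
    have hE2 : E2 ≤ 0 := by nlinarith [mul_nonneg (by linarith : (0 : ℝ) ≤ N) (by linarith : (0 : ℝ) ≤ 8 - 2 * N)]
    have hμ : (N : ℝ) * (E1 - E0) ≤ N * 3 := by linarith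
    have hμ' : E1 - E0 ≤ 3 := le_of_mul_le_mul_left hμ (by linarith)
    nlinarith
  · have hV : (27 : ℝ) ≤ (L : ℝ) ^ 3 := by
      have h3 : (3 : ℝ) ≤ L := by exact_mod_cast (show 3 ≤ L by omega)
      have h := pow_le_pow_left₀ (by norm_num : (0 : ℝ) ≤ 3) h3 3
      norm_num at h
      exact h
    have hs2 : (N : ℝ) * ((E1 - E0) * ((L : ℝ) ^ 3 - 1)) ≤
        N * (-3 * (L : ℝ) ^ 3 + 12 * N - 3) := by
      have h4 : (N : ℝ) * (E1 - E0) * ((L : ℝ) ^ 3 - 1) ≤ (E2 + 3 * N) * ((L : ℝ) ^ 3 - 1) :=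
        mul_le_mul_of_nonneg_right hs1 (by linarith)
      nlinarith
    have hs3 : (E1 - E0) * ((L : ℝ) ^ 3 - 1) ≤ -3 * (L : ℝ) ^ 3 + 12 * N - 3 :=
      le_of_mul_le_mul_left hs2 (by linarith)
    by_cases hμ : 0 ≤ E1 - E0 + 3
    · have h5 : (E1 - E0 + 3) * 7 ≤ (E1 - E0 + 3) * ((L : ℝ) ^ 3 - 1) :=
        mul_le_mul_of_nonneg_left (by linarith) hμ
      nlinarith
    · have h5 : (E1 - E0 + 3) * (L : ℝ) ^ 3 < 0 := mul_neg_of_neg_of_pos (by linarith) hL3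
      nlinarith


end Summit.AtomisticToContinuum.BoseEinsteinCondensation.Cruxes.InsertionFieldDelocalisation.MobileTrapDirichletEigenfunction

end
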